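import Mathlib
import HarnessLib
import Literature.MathematicalPhysics.QuantumFieldTheory.ConstructiveQFTWave0

/-!
# LatticeQCDFlow / Scaling — every generation order of the links of `(ℤ/L)^d` closes at least
# `d·#sites/4` plaquettes at distinct links: `2·#plaquettes = #sites·d(d−1)`, a link lies on at most
# `2(d−1)` plaquettes, and every plaquette has a last link

HONEST FRAMING: exact (Metropolis-corrected) sampling algorithms for lattice gauge theory;
figures of merit are autocorrelation/cost numbers at stated couplings and volumes; no
continuum-physics claim.

Venture `LatticeQCDFlow` (cell pub-lqcd), topic `Scaling`, FANOUT row 30 (lean-1, GEN-21) — OUR WORK on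
THEORY-2.md §4 row C5 (autoregressive context), the COUNTING step of the volume law: the extensive
training-loss floor of `Scaling/AutoregressiveGaugeKLExtensive` charges `≥ ⟨(1/N)Re tr U_p⟩²/2` nats
for every link generated after the other three links of one of its plaquettes («witnessed»); how many
links of an ARBITRARY generation order are witnessed?  Every plaquette has a last link; the map
`plaquette ↦ its last link` has fibres of size `≤ 2(d−1)` (the number of plaquettes through a link);
hence `#witnessed ≥ #plaquettes/(2(d−1)) = d·#sites/4` — `#sites/2` in two dimensions, `#sites = L^4`
in four (all six orientations counted; the `(0,1)`-plane alone gives `#sites/3` in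
`Scaling/AutoregressiveGaugeKLExtensiveAnyOrder`).  Pure lattice combinatorics; no measure theory.

## What is proved (all [ours] unless marked)

* §1 `card_filter_lt_mul_two` — `2·#{(i,j) : i < j} = d(d−1)` [folklore]; **`two_mul_card_plaquette`** —
  `2·#plaquettes = #sites·d(d−1)` on `(ℤ/L)^d`.
* §2 **`card_filter_mem_plaquetteLinks_le`** — a link `(y, μ)` lies on at most `2(d−1)` plaquettes
  (injection `p ↦ (direction of p other than μ, base site of p)` into `⋃_{ν ≠ μ} {(ν, y), (ν, y − e_ν)}`).
* §3 **`exists_lastLinks_all`** (`d ≥ 2`; `l` a list containing every link) — a finite set `T` of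
  links and plaquettes `P e ∋ e` (`e ∈ T`) all of whose other links come EARLIER in `l` (strictly, by
  `List.idxOf`), with `#plaquettes ≤ 2(d−1)·#T`.

Consumed by `Scaling/AutoregressiveGaugeKLExtensiveAllPlanes` (the volume law with all orientations).
No `def`, no `sorry`, nothing cited as a fact.
-/

namespace Summit.Ventures.LatticeQCDFlow.Theory2.Autoregressive

open Literature.MathematicalPhysics.QuantumFieldTheory

/-! ## §1 Counting plaquettes -/

/-- Twice the number of axis pairs `i < j` of `Fin d` is `d(d−1)`. [folklore] -/
theorem card_filter_lt_mul_two (d : ℕ) :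
    ((Finset.univ : Finset (Fin d × Fin d)).filter (fun p => p.1 < p.2)).card * 2 = d * (d - 1) := by
  classical
  have h1 : (Finset.univ : Finset (Fin d × Fin d)).filter (fun p => p.1 < p.2) =
      (Finset.univ : Finset (Fin d)).biUnion
        (fun j => (Finset.Iio j).map ⟨fun i => (i, j), fun a b h => (Prod.mk.inj h).1⟩) := by
    ext ⟨i, j⟩
    simp only [Finset.mem_filter, Finset.mem_univ, true_and, Finset.mem_biUnion, Finset.mem_map,
      Finset.mem_Iio, Function.Embedding.coeFn_mk, Prod.mk.injEq]
    constructor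
    · intro h; exact ⟨j, i, h, rfl, rfl⟩
    · rintro ⟨j', i', h, rfl, rfl⟩; exact h
  rw [h1, Finset.card_biUnion]
  · simp only [Finset.card_map, Fin.card_Iio]
    rw [Fin.sum_univ_eq_sum_range (fun j => j), Finset.sum_range_id_mul_two]
  · intro j _ j' _ hjj'
    simp only [Function.onFun]
    rw [Finset.disjoint_left]
    intro p hp hp'
    simp only [Finset.mem_map, Finset.mem_Iio, Function.Embedding.coeFn_mk] at hp hp'
    obtain ⟨i, -, rfl⟩ := hp
    obtain ⟨i', -, h⟩ := hp'
    exact hjj' (Prod.mk.inj h).2.symm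

/-- `2·#plaquettes = #sites·d(d−1)` on the periodic lattice `(ℤ/L)^d`. [folklore] -/
theorem two_mul_card_plaquette (d L : ℕ) [NeZero L] :
    2 * Fintype.card (Plaquette d L) = Fintype.card (Site d L) * (d * (d - 1)) := by
  classical
  rw [Fintype.card_prod, Fintype.card_subtype, ← card_filter_lt_mul_two d]
  ring

/-! ## §2 A link lies on at most `2(d−1)` plaquettes -/

/-- **A link lies on at most `2(d−1)` plaquettes**: the plaquettes `(x; i, j)` (`i < j`) having the link
`e = (y, μ)` among their four links inject into `{ν ≠ μ} × {y, y − e_ν}` by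
`p ↦ (its direction other than μ, its base site)`. [ours] -/
theorem card_filter_mem_plaquetteLinks_le {d L : ℕ} [NeZero L] (e : Edge d L) :
    ((Finset.univ : Finset (Plaquette d L)).filter (fun p => e ∈
      ({(p.1, p.2.1.1), (p.1.shift p.2.1.1, p.2.1.2), (p.1.shift p.2.1.2, p.2.1.1), (p.1, p.2.1.2)} :
        Finset (Edge d L)))).card ≤ 2 * (d - 1) := by
  classical
  set μ := e.2 with hμ
  set y := e.1 with hy
  set f : Plaquette d L → Fin d × Site d L :=
    fun p => (if p.2.1.1 = μ then p.2.1.2 else p.2.1.1, p.1) with hf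
  set T' : Finset (Fin d × Site d L) :=
    (Finset.univ.erase μ).biUnion (fun ν => {(ν, y), (ν, y - Pi.single ν 1)}) with hT'def
  have hT' : T'.card ≤ 2 * (d - 1) := by
    calc T'.card ≤ ∑ ν ∈ Finset.univ.erase μ, ({(ν, y), (ν, y - Pi.single ν 1)} : Finset _).card :=
          Finset.card_biUnion_le
      _ ≤ ∑ ν ∈ Finset.univ.erase μ, 2 := Finset.sum_le_sum fun ν _ => Finset.card_le_two
      _ = 2 * (d - 1) := by
          rw [Finset.sum_const, smul_eq_mul, Finset.card_erase_of_mem (Finset.mem_univ _),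
            Finset.card_univ, Fintype.card_fin]; ring
  have hstar : ∀ p : Plaquette d L, e ∈ ({(p.1, p.2.1.1), (p.1.shift p.2.1.1, p.2.1.2),
      (p.1.shift p.2.1.2, p.2.1.1), (p.1, p.2.1.2)} : Finset (Edge d L)) →
      ((p.2.1.1 = μ ∧ (f p).1 = p.2.1.2) ∨ (p.2.1.2 = μ ∧ (f p).1 = p.2.1.1)) ∧
        (p.1 = y ∨ p.1 = y - Pi.single (f p).1 1) := by
    intro p hp
    have hij : p.2.1.1 ≠ p.2.1.2 := ne_of_lt p.2.2
    simp only [Finset.mem_insert, Finset.mem_singleton] at hp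
    rcases hp with h | h | h | h
    · have h1 : y = p.1 := by rw [hy, h]
      have h2 : μ = p.2.1.1 := by rw [hμ, h]
      have hf1 : (f p).1 = p.2.1.2 := by simp [hf, h2]
      exact ⟨Or.inl ⟨h2.symm, hf1⟩, Or.inl h1.symm⟩
    · have h1 : y = p.1.shift p.2.1.1 := by rw [hy, h]
      have h2 : μ = p.2.1.2 := by rw [hμ, h]
      have hf1 : (f p).1 = p.2.1.1 := by simp [hf, h2, hij]
      refine ⟨Or.inr ⟨h2.symm, hf1⟩, Or.inr ?_⟩
      rw [hf1, h1]; simp [Site.shift]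
    · have h1 : y = p.1.shift p.2.1.2 := by rw [hy, h]
      have h2 : μ = p.2.1.1 := by rw [hμ, h]
      have hf1 : (f p).1 = p.2.1.2 := by simp [hf, h2]
      refine ⟨Or.inl ⟨h2.symm, hf1⟩, Or.inr ?_⟩
      rw [hf1, h1]; simp [Site.shift]
    · have h1 : y = p.1 := by rw [hy, h]
      have h2 : μ = p.2.1.2 := by rw [hμ, h]
      have hf1 : (f p).1 = p.2.1.1 := by simp [hf, h2, hij]
      exact ⟨Or.inr ⟨h2.symm, hf1⟩, Or.inl h1.symm⟩
  refine le_trans (Finset.card_le_card_of_injOn f (fun p hp => ?_) (fun p hp p' hp' hfeq => ?_)) hT'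
  · rw [Finset.mem_coe, Finset.mem_filter] at hp
    obtain ⟨hdir, hsite⟩ := hstar p hp.2
    have hν : (f p).1 ≠ μ := by
      rcases hdir with ⟨h2, hf1⟩ | ⟨h2, hf1⟩
      · rw [hf1, ← h2]; exact (ne_of_lt p.2.2).symm
      · rw [hf1, ← h2]; exact ne_of_lt p.2.2
    simp only [hT'def, Finset.coe_biUnion, Finset.mem_coe, Finset.mem_erase, Finset.mem_univ, and_true,
      Set.mem_iUnion, Finset.coe_insert, Finset.coe_singleton, Set.mem_insert_iff, Set.mem_singleton_iff,
      exists_prop]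
    refine ⟨(f p).1, hν, ?_⟩
    rcases hsite with hs | hs
    · left; exact Prod.ext rfl hs
    · right; exact Prod.ext rfl hs
  · rw [Finset.mem_coe, Finset.mem_filter] at hp hp'
    obtain ⟨hdir, -⟩ := hstar p hp.2
    obtain ⟨hdir', -⟩ := hstar p' hp'.2
    have hs : p.1 = p'.1 := congrArg Prod.snd hfeq
    have hν : (f p).1 = (f p').1 := congrArg Prod.fst hfeq
    have hlt := p.2.2
    have hlt' := p'.2.2
    have h2 : p.2.1 = p'.2.1 := by
      rcases hdir with ⟨h2, hf1⟩ | ⟨h2, hf1⟩ <;> rcases hdir' with ⟨h2', hf1'⟩ | ⟨h2', hf1'⟩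
      · exact Prod.ext (h2.trans h2'.symm) (hf1.symm.trans (hν.trans hf1'))
      · exfalso
        have a : μ < (f p).1 := by rw [hf1, ← h2]; exact hlt
        have b : (f p').1 < μ := by rw [hf1', ← h2']; exact hlt'
        rw [hν] at a; exact lt_asymm a b
      · exfalso
        have a : (f p).1 < μ := by rw [hf1, ← h2]; exact hlt
        have b : μ < (f p').1 := by rw [hf1', ← h2']; exact hlt'
        rw [hν] at a; exact lt_asymm a b
      · exact Prod.ext (hf1.symm.trans (hν.trans hf1')) (h2.trans h2'.symm)
    exact Prod.ext hs (Subtype.ext h2)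

/-! ## §3 Every order: at least `d·#sites/4` links close a plaquette -/

/-- **Every order has at least `#plaquettes/(2(d−1))` last links.**  `d ≥ 2`; `l` a list containing every
link.  The last link (in `l`) of each plaquette defines a set `T` of links, each `e ∈ T` lying on a
plaquette `P e` all of whose other links come EARLIER in `l` (strictly, by `idxOf`), with
`#plaquettes ≤ 2(d−1)·#T`. [ours] -/
theorem exists_lastLinks_all {d L : ℕ} [NeZero L] (hd : 2 ≤ d) (l : List (Edge d L)) (hall : ∀ e : Edge d L, e ∈ l) :
    ∃ (T : Finset (Edge d L)) (P : Edge d L → Plaquette d L),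
      (∀ e ∈ T, e ∈ ({((P e).1, (P e).2.1.1), ((P e).1.shift (P e).2.1.1, (P e).2.1.2),
        ((P e).1.shift (P e).2.1.2, (P e).2.1.1), ((P e).1, (P e).2.1.2)} : Finset (Edge d L))) ∧
      (∀ e ∈ T, ∀ e' ∈ ({((P e).1, (P e).2.1.1), ((P e).1.shift (P e).2.1.1, (P e).2.1.2),
        ((P e).1.shift (P e).2.1.2, (P e).2.1.1), ((P e).1, (P e).2.1.2)} : Finset (Edge d L)),
        e' ≠ e → l.idxOf e' < l.idxOf e) ∧
      Fintype.card (Plaquette d L) ≤ 2 * (d - 1) * T.card := by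
  classical
  set pl : Plaquette d L → Finset (Edge d L) := fun p =>
    {(p.1, p.2.1.1), (p.1.shift p.2.1.1, p.2.1.2), (p.1.shift p.2.1.2, p.2.1.1), (p.1, p.2.1.2)} with hpl
  have hex : ∀ p : Plaquette d L, ∃ e ∈ pl p, ∀ e' ∈ pl p, l.idxOf e' ≤ l.idxOf e := fun p =>
    Finset.exists_max_image (pl p) (fun e => l.idxOf e) ⟨(p.1, p.2.1.1), by simp [hpl]⟩
  choose last hlast_mem hlast_max using hex
  set T : Finset (Edge d L) := Finset.univ.image last with hTdef
  have p₀ : Plaquette d L := (fun _ => 0, ⟨(⟨0, by omega⟩, ⟨1, by omega⟩), by rw [Fin.lt_def]; norm_num⟩)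
  have hpOf : ∀ e : Edge d L, ∃ p : Plaquette d L, e ∈ T → last p = e := by
    intro e
    by_cases he : e ∈ T
    · obtain ⟨p, -, hp⟩ := Finset.mem_image.1 he
      exact ⟨p, fun _ => hp⟩
    · exact ⟨p₀, fun h => absurd h he⟩
  choose P hP using hpOf
  have hPl : ∀ e, ({((P e).1, (P e).2.1.1), ((P e).1.shift (P e).2.1.1, (P e).2.1.2),
      ((P e).1.shift (P e).2.1.2, (P e).2.1.1), ((P e).1, (P e).2.1.2)} : Finset (Edge d L)) = pl (P e) :=
    fun e => by simp [hpl]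
  refine ⟨T, P, fun e he => ?_, fun e he e' he' hne' => ?_, ?_⟩
  · have h := hlast_mem (P e)
    rw [hP e he] at h
    rw [hPl e]
    exact h
  · rw [hPl e] at he'
    have hle : l.idxOf e' ≤ l.idxOf (last (P e)) := hlast_max (P e) e' he'
    rw [hP e he] at hle
    refine lt_of_le_of_ne hle fun heq => hne' ?_
    exact (List.idxOf_inj (hall e')).1 heq
  · -- a link is the last link of at most `2(d-1)` plaquettes
    have hfib : ∀ e ∈ (Finset.univ : Finset (Plaquette d L)).image last,
        (Finset.univ.filter (fun p => last p = e)).card ≤ 2 * (d - 1) := by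
      intro e _
      have hsub : Finset.univ.filter (fun p => last p = e) ⊆
          Finset.univ.filter (fun p => e ∈ pl p) := by
        intro p hp
        rw [Finset.mem_filter] at hp ⊢
        exact ⟨hp.1, hp.2 ▸ hlast_mem p⟩
      exact (Finset.card_le_card hsub).trans (card_filter_mem_plaquetteLinks_le e)
    have hcount := Finset.card_le_mul_card_image (f := last) (Finset.univ : Finset (Plaquette d L))
      (2 * (d - 1)) hfib
    rwa [Finset.card_univ] at hcount

end Summit.Ventures.LatticeQCDFlow.Theory2.Autoregressive
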